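import Summits.HodgeConjecture.HodgeConjecture.Theorems.WeilTypeLadderRankTwoCMField
import HarnessLib

/-!
# WeilTypeLadder · Weil classes of EVERY subfield `E′ ⊂ E` of a field `E = ℚ(θ)` of degree `dim A` acting with rank `2` and balanced multiplicities: `W_{E′} ⊗ ℂ ⊆ Nᵐ` — the CM-field rung R3 on the type-II loci, unconditionally

b2b cell `hweil` (packet `run/shared/lean/b2b/hodge-weil/`, `b2b-hweil-pv3-g36/TYPE-II-LOCI.md` §8; prover 3). The sibling
`Theorems/WeilTypeLadderRankTwoCMField.lean` treats an imaginary QUADRATIC subfield `K ⊂ E` (rungs R∞ / R1′, carrier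
`weilClassesOf`). THIS file runs the same Moonen–Zarhin mechanism (Crelle 496 (1998) §2: for `E′ ⊂ E`,
`⋀^{r[E:E′]} V_{ℂ,τ}(E′) = ⊗_{σ|τ} ⋀^r V_{ℂ,σ}(E)`, so `W_{E′}` lies in the span of `[E:E′]`-fold products of classes of
`W_E`; with `r = 2` and balanced multiplicities `W_E ⊂ H²` is divisorial by their §1 Criterion and Lefschetz `(1,1)`) for a
subfield `E′ = ℚ(φ′) ⊂ E` of ANY degree `e`, on the carrier `weilClassesField A φ′ P′ (2m)` of the CM-FIELD rung R3
(`WeilTypeLadder.WeilClassesCMField`: Weil classes `W_{E′}` for a CM field `E′` of degree `e > 2` acting with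
`e · 2m = 2 dim A`; Markman, arXiv:2509.23403 §12: "We expect … the algebraicity of Weil classes … for CM-fields `K` with
`[K:ℚ] > 2`"; OPEN for the general member for every `e > 2`; known on Schoen's cyclic Prym loci and at tensor points).

* `weilClassesField_le_algebraicClasses_of_subfield_rankTwoField` — MAIN THEOREM: `A` a complex abelian variety;
  `θ : A ⟶ A` with `P(θ) = 0`, `P ∈ ℤ[T]` monic irreducible of degree `dim A` (`E = ℚ(θ)`, `E`-rank `2`) and balanced
  multiplicities; `φ′ : A ⟶ A` with `P′(φ′) = 0`, `P′` monic irreducible of degree `e`, `e · m = dim A`, and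
  `N • φ′ = S(θ)` (`E′ = ℚ(φ′) ⊂ E`, `[E:E′] = m`) ⟹ `weilClassesField A φ′ P′ (2 * m) ≤ algebraicClasses A.X m`.
  Proof: each root `σ` of `P` maps to the root `s(σ) = S(σ)/N` of `P′` (`φ′^*` acts on `V_σ(θ)` by `s(σ)`); the fibres
  of `s` over the `e` roots `τ` of `P′` have `≤ m` elements each (an eigenbasis of `⊕_{s(σ)=τ} V_σ(θ)` is linearly
  independent inside `V_τ(φ′)`, of dimension `2m` — `finrank_eigenspace_eq_of_root`) and `dim A = e·m` elements in
  total, hence EXACTLY `m` each; `ω_τ := ⌣_{s(σ)=τ} (u_σ ⌣ v_σ)` is a non-zero algebraic class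
  (`cupPowOne_mem_algebraicClasses_of_pairs` of the sibling; each pair in `⋀² V_σ ⊆ W_E ⊗ ℂ ⊆ N¹`) spanning the Weil LINE
  `⋀^{2m} V_τ(φ′)` (`exists_generator_pullbackEigenclasses_of_root`), and `W_{E′} ⊗ ℂ = ⊕_τ ⋀^{2m} V_τ`. NO named fact.
* `weilClassesCMField_rankTwoField` — the LITERAL body of R3 (`WeilClassesCMField`, binders verbatim; the CM binders
  'no real root' / 'a conjugation polynomial `Q`' carried unused) with the structure `(θ, P, S, N, balanced)` inserted,
  and `weilClassesCMField_rankTwoField_of_hodgeConjecture` (on-path, through `WeilTypeLadderOnPath`).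

WHO (packet §8; as §3 there): abelian `g`-folds with a totally indefinite quaternion algebra `D ⊃ E ⊃ E′` over the totally
real `F₀ = E ∩ ℝ` (type II(`g/2`), `m = 1`; general member of the `g/2`-dimensional family `S_D` SIMPLE when `D` is a
division algebra), RM squares, CM points; for EVERY CM field `E′` of degree `e` and EVERY `m ≥ 2` such `A` of dimension
`e·m` exist in positive-dimensional families (`E := E′·L`, `L` totally real of degree `m`). In print for the algebraicity:
Moonen–Zarhin 1998, second Criterion (type 1/2 ⟹ `W_F` decomposable for every subfield `F`); Murty 1988 Thm. 2. HONEST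
LABEL: CASES of R3 on proper sub-loci, not the rung; 0 unconditional rungs above the floor are added; Markman-free.
-/

noncomputable section

-- every declaration of this problem lives in `Summit.HodgeConjecture.HodgeConjecture.…` (summit = sub-problem)
set_option linter.dupNamespace false

open CategoryTheory
open Literature.AlgebraicGeometry Literature.AlgebraicGeometry.Motives
open Literature.AlgebraicGeometry.HodgeTheory
open Literature.AlgebraicTopology.SingularHomology

namespace Summit.HodgeConjecture.HodgeConjecture.WeilTypeLadder

section RankTwoFieldSubfields

/-- **MAIN THEOREM — `W_{E′} ⊗ ℂ ⊆ Nᵐ` for every subfield `E′ = ℚ(φ′)` of a field `E = ℚ(θ) ⊂ End⁰(A)` of degree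
`dim A` acting with `E`-rank `2` and balanced multiplicities.** Carriers: `θ` with `P(θ) = 0`, `P ∈ ℤ[T]` monic of degree
`dim A` irreducible over `ℚ`, `eigenMultiplicity A θ ρ = eigenMultiplicity A θ ρ̄` at every root; `φ′` with `P′(φ′) = 0`,
`P′ ∈ ℤ[T]` monic irreducible of degree `e`, `e · m = dim A`; `N • φ′ = S(θ)`, `N ≥ 1`. Conclusion:
`weilClassesField A φ′ P′ (2 * m) ≤ algebraicClasses A.X m` (Moonen–Zarhin's `W_{E′} ⊗ ℂ = ⊕_τ ⋀^{2m} V_{ℂ,τ}` is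
spanned by products of divisor classes). No named fact.
[cite: MoonenZarhin1998WeilClasses, §1 Criterion and §2 (tensor decomposition; second Criterion)]
[cite: vanGeemen1994HodgeAV, 4.9] [cite: VoisinHodgeII2003, Prop. 9.20] -/
theorem weilClassesField_le_algebraicClasses_of_subfield_rankTwoField {A : AbelianVariety ℂ} {e m N : ℕ}
    {θ φ' : A ⟶ A} {P P' S : Polynomial ℤ} (hPm : P.Monic) (hPe : P.natDegree = A.dim)
    (hPirr : Irreducible (P.map (Int.castRingHom ℚ)))
    (hθ : Polynomial.eval₂ (Int.castRingHom (CategoryTheory.End A)) (θ : CategoryTheory.End A) P = 0)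
    (hbal : ∀ ρ : ℂ, Polynomial.eval₂ (Int.castRingHom ℂ) ρ P = 0 →
      eigenMultiplicity A θ ρ = eigenMultiplicity A θ (starRingEnd ℂ ρ))
    (hP'm : P'.Monic) (hP'e : P'.natDegree = e) (hP'irr : Irreducible (P'.map (Int.castRingHom ℚ)))
    (hφ' : Polynomial.eval₂ (Int.castRingHom (CategoryTheory.End A)) (φ' : CategoryTheory.End A) P' = 0)
    (hem : e * m = A.dim) (hN : 0 < N)
    (hS : ((N • φ' : A ⟶ A) : CategoryTheory.End A) =
      Polynomial.eval₂ (Int.castRingHom (CategoryTheory.End A)) (θ : CategoryTheory.End A) S) :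
    weilClassesField A φ' P' (2 * m) ≤ algebraicClasses A.X m := by
  classical
  haveI := finite_complexBetti_abelianVariety A 1
  have hX : IsSmoothProjective A.dim A.X := AbelianVariety.isSmoothProjective_holds (A := A)
  have her : A.dim * 2 = 2 * A.dim := by ring
  have her1 : A.dim * (2 * 1) = 2 * A.dim := by ring
  have her' : e * (2 * m) = 2 * A.dim := by rw [← hem]; ring
  set T : Module.End ℂ (complexBetti A.X 1) := (complexBetti.map θ.hom.hom.hom 1).hom with hT
  set F : Module.End ℂ (complexBetti A.X 1) := (complexBetti.map φ'.hom.hom.hom 1).hom with hF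
  set s : ℂ → ℂ := fun ρ => Polynomial.eval₂ (Int.castRingHom ℂ) ρ S / (N : ℂ) with hs
  have hN' : (N : ℂ) ≠ 0 := Nat.cast_ne_zero.2 hN.ne'
  -- (1) `φ'^*` acts on `V_ρ(θ)` by `s ρ`
  have hFρ : ∀ {ρ : ℂ} {v : complexBetti A.X 1}, v ∈ Module.End.eigenspace T ρ → F v = s ρ • v := by
    intro ρ v hv
    have h1 := Module.End.mem_eigenspace_iff.1 (mem_eigenspace_map_one_of_eq_eval₂ hS hv)
    have h2 : (complexBetti.map (N • φ').hom.hom.hom 1).hom v = (N : ℂ) • F v := by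
      rw [complexBetti_map_nsmul_one, ModuleCat.hom_nsmul, LinearMap.smul_apply, Nat.cast_smul_eq_nsmul]
    rw [h2] at h1
    calc F v = (N : ℂ)⁻¹ • ((N : ℂ) • F v) := by rw [smul_smul, inv_mul_cancel₀ hN', one_smul]
      _ = s ρ • v := by
        rw [h1, smul_smul]
        simp only [hs, div_eq_inv_mul]
  -- (2) eigenspaces of `θ` at roots have dimension 2; `s` maps roots of `P` to roots of `P'`
  have hdim : ∀ {ρ : ℂ}, Polynomial.eval₂ (Int.castRingHom ℂ) ρ P = 0 →
      Module.finrank ℂ (Module.End.eigenspace T ρ) = 2 := fun hρ =>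
    finrank_eigenspace_eq_of_root hPm hPe hPirr hθ her hρ
  have hF' : Polynomial.aeval F (P'.map (Int.castRingHom ℂ)) = 0 := aeval_hom_complexBetti_map_one_eq_zero hφ'
  have hsroot : ∀ {ρ : ℂ}, Polynomial.eval₂ (Int.castRingHom ℂ) ρ P = 0 →
      Polynomial.eval₂ (Int.castRingHom ℂ) (s ρ) P' = 0 := by
    intro ρ hρ
    have hne : Module.End.eigenspace T ρ ≠ ⊥ := by
      intro h
      have h2 := hdim hρ
      rw [h, finrank_bot] at h2
      exact two_ne_zero h2.symm
    obtain ⟨v, hv, hv0⟩ := Submodule.exists_mem_ne_zero_of_ne_bot hne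
    have hvec : Module.End.HasEigenvector F (s ρ) v :=
      Module.End.hasEigenvector_iff.2 ⟨Module.End.mem_eigenspace_iff.2 (hFρ hv), hv0⟩
    have h := Module.End.aeval_apply_of_hasEigenvector (p := P'.map (Int.castRingHom ℂ)) hvec
    rw [hF', LinearMap.zero_apply] at h
    have h0 : Polynomial.eval (s ρ) (P'.map (Int.castRingHom ℂ)) = 0 := (smul_eq_zero.1 h.symm).resolve_right hv0
    rwa [Polynomial.eval_map] at h0
  -- (3) the roots: `R` of `P` (|R| = dim A), `R'` of `P'` (|R'| = e), the fibres of `s`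
  have hP0 : P ≠ 0 := hPm.ne_zero
  have hP'0 : P' ≠ 0 := hP'm.ne_zero
  have hsepC : (P.map (Int.castRingHom ℂ)).Separable := by
    rw [map_castRingHom_complex_eq]; exact hPirr.separable.map
  have hsepC' : (P'.map (Int.castRingHom ℂ)).Separable := by
    rw [map_castRingHom_complex_eq]; exact hP'irr.separable.map
  set R : Finset ℂ := (P.map (Int.castRingHom ℂ)).roots.toFinset with hR
  set R' : Finset ℂ := (P'.map (Int.castRingHom ℂ)).roots.toFinset with hR'
  have hmemR : ∀ {ρ : ℂ}, ρ ∈ R ↔ Polynomial.eval₂ (Int.castRingHom ℂ) ρ P = 0 := fun {ρ} =>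
    mem_roots_toFinset_map_iff hP0 ρ
  have hmemR' : ∀ {τ : ℂ}, τ ∈ R' ↔ Polynomial.eval₂ (Int.castRingHom ℂ) τ P' = 0 := fun {τ} =>
    mem_roots_toFinset_map_iff hP'0 τ
  have hRcard : R.card = A.dim := by
    rw [hR, Multiset.toFinset_card_of_nodup (Polynomial.nodup_roots hsepC),
      Polynomial.splits_iff_card_roots.1 (IsAlgClosed.splits _),
      Polynomial.natDegree_map_eq_of_injective (RingHom.injective_int (Int.castRingHom ℂ)), hPe]
  have hR'card : R'.card = e := by
    rw [hR', Multiset.toFinset_card_of_nodup (Polynomial.nodup_roots hsepC'),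
      Polynomial.splits_iff_card_roots.1 (IsAlgClosed.splits _),
      Polynomial.natDegree_map_eq_of_injective (RingHom.injective_int (Int.castRingHom ℂ)), hP'e]
  have hmaps : Set.MapsTo s ↑R ↑R' := fun ρ hρ => by
    rw [Finset.mem_coe] at hρ ⊢
    exact hmemR'.2 (hsroot (hmemR.1 hρ))
  let Fib : ℂ → Finset ℂ := fun τ => R.filter (fun σ => s σ = τ)
  have hFib : ∀ {τ σ : ℂ}, σ ∈ Fib τ ↔ σ ∈ R ∧ s σ = τ := fun {τ σ} => Finset.mem_filter
  -- an eigenbasis of `H¹` adapted to `θ^*`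
  have hTP : Polynomial.aeval T (P.map (Int.castRingHom ℂ)) = 0 := aeval_hom_complexBetti_map_one_eq_zero hθ
  have hss : Module.End.IsSemisimple T :=
    Module.End.isSemisimple_of_squarefree_aeval_eq_zero hsepC.squarefree hTP
  have hint : DirectSum.IsInternal T.eigenspace :=
    DirectSum.isInternal_submodule_of_iSupIndep_of_iSup_eq_top T.eigenspaces_iSupIndep
      hss.iSup_eigenspace_eq_top
  let bE : ∀ ρ : ℂ, Module.Basis (Fin (Module.finrank ℂ (T.eigenspace ρ))) ℂ (T.eigenspace ρ) :=
    fun ρ => Module.finBasis ℂ _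
  let b₀ := hint.collectedBasis bE
  -- (4) for every `τ`: the family `w τ : Fin (2 k) → H¹`, `k = |Fib τ|`, two eigenvectors per `σ ∈ Fib τ`
  let k : ℂ → ℕ := fun τ => (Fib τ).card
  let eτ : ∀ τ : ℂ, Fin (k τ) ≃ ↥(Fib τ) := fun τ => (Finset.equivFin (Fib τ)).symm
  have heR : ∀ (τ : ℂ) (j : Fin (k τ)), Polynomial.eval₂ (Int.castRingHom ℂ) (eτ τ j : ℂ) P = 0 := fun τ j =>
    hmemR.1 (hFib.1 (eτ τ j).2).1
  have hes : ∀ (τ : ℂ) (j : Fin (k τ)), s (eτ τ j : ℂ) = τ := fun τ j => (hFib.1 (eτ τ j).2).2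
  let half : ∀ τ : ℂ, Fin (2 * k τ) → Fin (k τ) := fun τ i => ⟨i.val / 2, by omega⟩
  let par : ∀ τ : ℂ, Fin (2 * k τ) → Fin 2 := fun τ i => ⟨i.val % 2, Nat.mod_lt _ two_pos⟩
  let g' : ∀ τ : ℂ, Fin (k τ) → Fin 2 → (Σ ρ : ℂ, Fin (Module.finrank ℂ (T.eigenspace ρ))) := fun τ j c =>
    ⟨(eτ τ j : ℂ), Fin.cast (hdim (heR τ j)).symm c⟩
  let g : ∀ τ : ℂ, Fin (2 * k τ) → (Σ ρ : ℂ, Fin (Module.finrank ℂ (T.eigenspace ρ))) := fun τ i =>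
    g' τ (half τ i) (par τ i)
  have hg' : ∀ (τ : ℂ) (j j' : Fin (k τ)) (c c' : Fin 2), g' τ j c = g' τ j' c' → j = j' ∧ c = c' := by
    intro τ j j' c c' h
    obtain ⟨h1, h2⟩ := Sigma.mk.inj_iff.1 h
    have hj : j = j' := (eτ τ).injective (Subtype.ext h1)
    subst hj
    exact ⟨rfl, Fin.cast_injective _ (eq_of_heq h2)⟩
  have hg : ∀ τ : ℂ, Function.Injective (g τ) := by
    intro τ i i' h
    obtain ⟨h1, h2⟩ := hg' τ _ _ _ _ h
    have h1' : i.val / 2 = i'.val / 2 := congrArg Fin.val h1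
    have h2' : i.val % 2 = i'.val % 2 := congrArg Fin.val h2
    exact Fin.ext (by omega)
  let w : ∀ τ : ℂ, Fin (2 * k τ) → complexBetti A.X 1 := fun τ i => b₀ (g τ i)
  have hwT : ∀ (τ : ℂ) (i : Fin (2 * k τ)), w τ i ∈ Module.End.eigenspace T (eτ τ (half τ i) : ℂ) := fun τ i =>
    hint.collectedBasis_mem bE (g τ i)
  have hwF : ∀ (τ : ℂ) (i : Fin (2 * k τ)), w τ i ∈ Module.End.eigenspace F τ := by
    intro τ i
    rw [Module.End.mem_eigenspace_iff, hFρ (hwT τ i), hes]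
  have hwli : ∀ τ : ℂ, LinearIndependent ℂ (w τ) := fun τ => b₀.linearIndependent.comp (g τ) (hg τ)
  -- (5) fibre sizes: `k τ ≤ m` on `R'`, total `dim A = e·m`, hence `k τ = m` on `R'`
  have hkle : ∀ τ ∈ R', k τ ≤ m := by
    intro τ hτ
    have hdimτ : Module.finrank ℂ (Module.End.eigenspace F τ) = 2 * m :=
      finrank_eigenspace_eq_of_root hP'm hP'e hP'irr hφ' her' (hmemR'.1 hτ)
    have hspan : Submodule.span ℂ (Set.range (w τ)) ≤ Module.End.eigenspace F τ :=
      Submodule.span_le.2 (by rintro _ ⟨i, rfl⟩; exact hwF τ i)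
    have h := Submodule.finrank_mono hspan
    rw [finrank_span_eq_card (hwli τ), Fintype.card_fin, hdimτ] at h
    omega
  have hsum : R.card = ∑ τ ∈ R', k τ := Finset.card_eq_sum_card_fiberwise hmaps
  have hkeq : ∀ τ ∈ R', k τ = m := by
    have hle : ∑ τ ∈ R', k τ ≤ ∑ τ ∈ R', m := Finset.sum_le_sum hkle
    have heq : ∑ τ ∈ R', k τ = ∑ τ ∈ R', m := by
      rw [← hsum, Finset.sum_const, smul_eq_mul, hR'card, hRcard, ← hem]
    exact (Finset.sum_eq_sum_iff_of_le hkle).1 heq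
  -- (6) `W_E ⊗ ℂ ⊆ N¹`, and the pair products are algebraic
  have hWE : weilClassesField A θ P (2 * 1) ≤ algebraicClasses A.X 1 :=
    weilClassesField_le_of_forall_isRationalClass hPirr hθ fun c hc hcQ =>
      lefschetzOneOne_rational_holds hX c hcQ
        (isOfHodgeType_of_mem_weilClassesField_of_balanced hPm hPe hPirr hθ her1 hbal hc)
  have hhalf : ∀ (τ : ℂ) (j : Fin (k τ)) (c : Fin (2 * 1)), half τ ⟨2 * j.val + c.val, by omega⟩ = j := by
    intro τ j c
    apply Fin.ext
    change (2 * j.val + c.val) / 2 = j.val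
    omega
  have hpair : ∀ (τ : ℂ) (j : Fin (k τ)), cupPowOne ℂ (ComplexPoints A.X) (2 * 1)
      (fun c : Fin (2 * 1) => w τ ⟨2 * j.val + c.val, by omega⟩) ∈ algebraicClasses A.X 1 := by
    intro τ j
    have hjT : ∀ c : Fin (2 * 1), w τ ⟨2 * j.val + c.val, by omega⟩ ∈
        Module.End.eigenspace T (eτ τ j : ℂ) := by
      intro c
      have h := hwT τ ⟨2 * j.val + c.val, by omega⟩
      rwa [hhalf τ j c] at h
    exact hWE (pullbackEigenclasses_le_weilClassesField (heR τ j)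
      (cupPowOne_mem_pullbackEigenclasses_pow θ hjT))
  -- (7) each Weil line `⋀^{2m} V_τ(φ')`, `τ ∈ R'`, is spanned by a non-zero algebraic class
  have key : ∀ τ ∈ R', pullbackEigenclasses A φ' (2 * m) (fun x y => ((x : ℂ) + (y : ℂ) * τ) ^ (2 * m)) ≤
      algebraicClasses A.X m := by
    intro τ hτ
    have hk : 2 * m = 2 * k τ := by rw [hkeq τ hτ]
    -- transport the family to `Fin (2 m)`
    let w' : Fin (2 * m) → complexBetti A.X 1 := fun i => w τ (Fin.cast hk i)
    have hw'li : LinearIndependent ℂ w' := (hwli τ).comp (Fin.cast hk) (Fin.cast_injective hk)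
    have hw'F : ∀ i, w' i ∈ Module.End.eigenspace F τ := fun i => hwF τ (Fin.cast hk i)
    set ω := cupPowOne ℂ (ComplexPoints A.X) (2 * m) w' with hω
    have hω0 : ω ≠ 0 := cupPowOne_ne_zero_of_linearIndependent A hw'li
    have hωL : ω ∈ pullbackEigenclasses A φ' (2 * m) (fun x y => ((x : ℂ) + (y : ℂ) * τ) ^ (2 * m)) :=
      cupPowOne_mem_pullbackEigenclasses_pow φ' hw'F
    have hωalg : ω ∈ algebraicClasses A.X m := by
      refine cupPowOne_mem_algebraicClasses_of_pairs A m w' fun j => ?_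
      have hj : j.val < k τ := by have := j.isLt; omega
      exact hpair τ ⟨j.val, hj⟩
    -- the line is generated by any non-zero member
    obtain ⟨ω₁, -, -, -, hgen⟩ :=
      exists_generator_pullbackEigenclasses_of_root hP'm hP'e hP'irr hφ' her' (hmemR'.1 hτ)
    obtain ⟨t₀, ht₀⟩ := hgen ω hωL
    have ht₀0 : t₀ ≠ 0 := by rintro rfl; exact hω0 (by rw [ht₀, zero_smul])
    intro c hc
    obtain ⟨t, ht⟩ := hgen c hc
    have hc' : c = (t * t₀⁻¹) • ω := by
      rw [ht₀, smul_smul, mul_assoc, inv_mul_cancel₀ ht₀0, mul_one, ht]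
    rw [hc']
    exact Submodule.smul_mem _ _ hωalg
  -- (8) `W_{E'} ⊗ ℂ = ⊕_{τ ∈ R'} ⋀^{2m} V_τ`
  intro c hc
  rw [mem_weilClassesField_iff] at hc
  refine (iSup₂_le fun τ hτ => key τ (hmemR'.2 hτ)) hc

/-! ### The R3 rung body on this locus -/

/-- **R3 on the locus.** The literal body of the CM-field rung `WeilTypeLadder.WeilClassesCMField` — for `A`, `φ`,
`P ∈ ℤ[T]` monic irreducible of degree `e > 2` with `P(φ) = 0`, `e · 2m = 2 dim A`, `K = ℚ(φ)` a CM field (no real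
root; one `Q` inducing complex conjugation — both carried unused), every RATIONAL `(m,m)`-class of
`weilClassesField A φ P (2m)` is algebraic — for those `(A, φ)` carrying in addition `θ` with `P₂(θ) = 0`, `P₂` monic
irreducible of degree `dim A`, balanced multiplicities, and `N • φ = S(θ)` (`K ⊂ E = ℚ(θ)`, `[E:K] = m`): the type-II
loci (and RM squares, CM points). Unconditional; no named fact. For EVERY CM field `K` of degree `e` and EVERY `m ≥ 2`
such abelian `em`-folds exist in positive-dimensional families (packet §8). A CASE of R3, not the rung.
[cite: MoonenZarhin1998WeilClasses, §1–§2] [cite: Markman2025SurveySecant, §12] -/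
theorem weilClassesCMField_rankTwoField :
    ∀ (A : AbelianVariety ℂ) (φ : A ⟶ A) (P : Polynomial ℤ) (e m : ℕ),
      P.Monic → P.natDegree = e → 2 < e → Irreducible (P.map (Int.castRingHom ℚ)) →
      Polynomial.eval₂ (Int.castRingHom (CategoryTheory.End A)) (φ : CategoryTheory.End A) P = 0 →
      e * (2 * m) = 2 * A.dim →
      (∀ ρ : ℂ, Polynomial.eval₂ (Int.castRingHom ℂ) ρ P = 0 → starRingEnd ℂ ρ ≠ ρ) →
      (∃ Q : Polynomial ℚ, ∀ ρ : ℂ, Polynomial.eval₂ (Int.castRingHom ℂ) ρ P = 0 →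
          Polynomial.eval₂ (algebraMap ℚ ℂ) ρ Q = starRingEnd ℂ ρ) →
      ∀ (θ : A ⟶ A) (P₂ S : Polynomial ℤ) (N : ℕ), P₂.Monic → P₂.natDegree = A.dim →
        Irreducible (P₂.map (Int.castRingHom ℚ)) →
        Polynomial.eval₂ (Int.castRingHom (CategoryTheory.End A)) (θ : CategoryTheory.End A) P₂ = 0 →
        (∀ ρ : ℂ, Polynomial.eval₂ (Int.castRingHom ℂ) ρ P₂ = 0 →
          eigenMultiplicity A θ ρ = eigenMultiplicity A θ (starRingEnd ℂ ρ)) →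
        0 < N →
        ((N • φ : A ⟶ A) : CategoryTheory.End A) =
          Polynomial.eval₂ (Int.castRingHom (CategoryTheory.End A)) (θ : CategoryTheory.End A) S →
      ∀ c ∈ weilClassesField A φ P (2 * m), IsRationalClass c →
        IsOfHodgeType A.dim A.X (2 * m) m m c → c ∈ algebraicClasses A.X m := by
  intro A φ P e m hPm hPe _ hPirr hφ hem _ _ θ P₂ S N hP₂m hP₂e hP₂irr hθ hbal hN hS c hc _ _
  have h2 : 2 * (e * m) = 2 * A.dim := by rw [← hem]; ring
  have hem' : e * m = A.dim := Nat.eq_of_mul_eq_mul_left two_pos h2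
  exact weilClassesField_le_algebraicClasses_of_subfield_rankTwoField hP₂m hP₂e hP₂irr hθ hbal hPm hPe hPirr hφ
    hem' hN hS hc

/-- **On-path lemma (R3 shape)**: the Hodge conjecture implies the same statement on the locus
(`HodgeConjecture → WeilClassesCMField →` the locus; the extra structure is not used). -/
theorem weilClassesCMField_rankTwoField_of_hodgeConjecture (h : _root_.HodgeConjecture) :
    ∀ (A : AbelianVariety ℂ) (φ : A ⟶ A) (P : Polynomial ℤ) (e m : ℕ),
      P.Monic → P.natDegree = e → 2 < e → Irreducible (P.map (Int.castRingHom ℚ)) →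
      Polynomial.eval₂ (Int.castRingHom (CategoryTheory.End A)) (φ : CategoryTheory.End A) P = 0 →
      e * (2 * m) = 2 * A.dim →
      (∀ ρ : ℂ, Polynomial.eval₂ (Int.castRingHom ℂ) ρ P = 0 → starRingEnd ℂ ρ ≠ ρ) →
      (∃ Q : Polynomial ℚ, ∀ ρ : ℂ, Polynomial.eval₂ (Int.castRingHom ℂ) ρ P = 0 →
          Polynomial.eval₂ (algebraMap ℚ ℂ) ρ Q = starRingEnd ℂ ρ) →
      ∀ (θ : A ⟶ A) (P₂ S : Polynomial ℤ) (N : ℕ), P₂.Monic → P₂.natDegree = A.dim →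
        Irreducible (P₂.map (Int.castRingHom ℚ)) →
        Polynomial.eval₂ (Int.castRingHom (CategoryTheory.End A)) (θ : CategoryTheory.End A) P₂ = 0 →
        (∀ ρ : ℂ, Polynomial.eval₂ (Int.castRingHom ℂ) ρ P₂ = 0 →
          eigenMultiplicity A θ ρ = eigenMultiplicity A θ (starRingEnd ℂ ρ)) →
        0 < N →
        ((N • φ : A ⟶ A) : CategoryTheory.End A) =
          Polynomial.eval₂ (Int.castRingHom (CategoryTheory.End A)) (θ : CategoryTheory.End A) S →
      ∀ c ∈ weilClassesField A φ P (2 * m), IsRationalClass c →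
        IsOfHodgeType A.dim A.X (2 * m) m m c → c ∈ algebraicClasses A.X m :=
  fun A φ P e m hPm hPe he hPirr hφ hem hnr hQ _ _ _ _ _ _ _ _ _ _ _ c hc hcQ hcH ↦
    weilClassesCMField_of_hodgeConjecture h A φ P e m hPm hPe he hPirr hφ hem hnr hQ c hc hcQ hcH

end RankTwoFieldSubfields

end Summit.HodgeConjecture.HodgeConjecture.WeilTypeLadder

end
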